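import Summits.BirchSwinnertonDyer.BirchSwinnertonDyer.Theorems.UniversalToricDescentHessianTwinSupplyAtThree
import Summits.BirchSwinnertonDyer.BirchSwinnertonDyer.Theorems.UniversalToricDescentToricKernelAtThreeApZeroOddDefectPTTROfPrint
import Literature.NumberTheory.EllipticCurves.BoxerDiao2010.TamagawaTwistHolds
import Literature.NumberTheory.EllipticCurves.BSDSelmerSkinnerThmBProofs
import Literature.NumberTheory.EllipticCurves.ManinConstantPotMultiplicativeProofs
import HarnessLib

/-!
# Route `UniversalToricDescent`, act R: THE PEU-RAMIFIÉ MULTIPLICATIVE RESUPPLY `S_A`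
# (`PeuRamifieMultTwinResupplyAtThree`, item stmt-BirchSwinnertonDyer-27387) IS A THEOREM — a multiplicative-at-`3`
# curve with `3 ∣ v₃(Δ_min)` has a `3`-congruent twin with GOOD reduction at `3`, an explicit member of its Hesse pencil

Width seat `bsd-wall-utd-p2-w2` (g3), named «natural owner of S_A» by the pen bsd-wall-pss3x g5 (act R, route rev 52–55).
`--workitem stmt-BirchSwinnertonDyer-27387`. BSD is not proved for any curve by this file.

THE CONSTRUCTION (explicit; no Serre–Tate, no modular interpretation of `X_E(3)`). Let `W′/ℚ` be globally minimal with
multiplicative reduction at `3` and `n = v₃(Δ_min(W′)) = 3n′` (`n′ ≥ 1`); write `c₄, c₆` for its integral invariants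
(`3 ∤ c₄`, `3 ∤ c₆`), `t = 3^{n′}`, `Δ_min = t³·δ` (`3 ∤ δ`), so `c₄³ − c₆² = 1728·t³·δ`. Take the member of Fisher's
Hesse pencil `E_{λ,μ} : y² = x³ − 27𝔠₄(λ,μ)x − 54𝔠₆(λ,μ)` of `W′` at
`(λ : μ) = (−c₆ + t·c₄ : c₄)`, i.e. `λ/μ = −c₆/c₄ + 3^{n′}` — a point at `3`-adic distance exactly `n′` from the centre
`−c₆/c₄` of the cluster of three cusps. Taylor expansion at the centre (where `𝔇 = −(c₄³−c₆²)(c₆²+3c₄³)/c₄⁴`,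
`𝔠₄ = −3(c₄³−c₆²)²/c₄³`, `𝔠₄‴ = 0`) gives the exact divisibilities
`𝔠₄(λ,μ) = t⁴·A`, `𝔠₆(λ,μ) = t⁶·B`, `𝔇(λ,μ) = t³·G` with INTEGER polynomials `A ≡ c₄⁵`, `B ≡ c₄⁶c₆`, `G ≡ −4c₄³c₆ (mod 3)`
(all `3`-adic units) and `A³ − B² = 1728·δ·G³` (§1). With `ρ ∈ ℤ`, `Aρ ≡ −B (mod 27)`, one has `3 ∣ ρ² − A` and
`27 ∣ ρ³ − 3Aρ − 2B` (§2), and the change of variables `(u, r) = (3t, 3t²ρ)` carries `E_{λ,μ}` to the INTEGER model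
`M = [0, ρ, 0, (ρ² − A)/3, (ρ³ − 3Aρ − 2B)/27]` with `c₄(M) = 16A`, `c₆(M) = 64B`, `Δ(M) = 2¹²·δ·G³`, a `3`-adic unit (§3).
Hence every global minimal model of `E_{λ,μ}` has good reduction at `3`, and `E_{λ,μ}[3] ≅ W′[3]` as `Γ_ℚ`-modules by
Fisher 2012 Thm. 13.2 (tree-proved, `threeCongruent_hessePencil3_unconditional`) (§4). §5: the route's support item
`PeuRamifieMultTwinResupplyAtThree` VERBATIM (`peuRamifieMultTwinResupplyAtThree_proof`), composing with the handed
congruence `W′[3] ≅ W[3]`; the extra hypotheses `ClassO6`, `r_an = 1`, `ρ̄₃` onto are not used.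

(The `3`-adic picture, found numerically before the proof: `𝔇 ≡ λ(λ + c₆μ)³`, `𝔠₄ ≡ c₄(λ + c₆μ)⁴ (mod 3)`; members at
distance `< n′` from the centre are multiplicative, at distance `> n′` additive potentially good, at distance exactly
`n′` good; for `3 ∤ n` (très ramifié) no member is good, as it must be.)

References: [Fisher2012Hessian] T. Fisher, The Hessian of a genus one curve, Proc. LMS (3) 104 (2012), §8, Thm. 13.2;
[SilvermanAEC2009] III §1 (`c₄, c₆, Δ`, `1728Δ = c₄³ − c₆²`), VII.1 Rem. 1.1, VII.5 Prop. 5.1; [Kraus1989] Prop. 2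
(integral models with given `(c₄, c₆)` at `p = 3`); [Serre1987] §2.9 (peu/très ramifié).
-/

set_option autoImplicit false
set_option linter.dupNamespace false

noncomputable section

namespace Summit.BirchSwinnertonDyer.BirchSwinnertonDyer.Theorems.UniversalToricDescentPeuRamifieResupply

open WeierstrassCurve IsDedekindDomain Rat.HeightOneSpectrum
  Literature.NumberTheory.EllipticCurves
  Literature.NumberTheory.EllipticCurves.BoxerDiao2010
  Literature.NumberTheory.EllipticCurves.BSZLemma17
  Literature.NumberTheory.EllipticCurves.Rank1Residual
  Literature.NumberTheory.EllipticCurves.Fisher2012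
  Summit.BirchSwinnertonDyer.Rank1Residual
  Summit.BirchSwinnertonDyer.BirchSwinnertonDyer.Theorems.UniversalToricDescentHessianTwin

/-! ## §0 An integer model with `p ∤ Δ` has good reduction at `p` -/

/-- **`p ∤ Δ(M)` for an INTEGER Weierstrass model `M` ⟹ `M ⊗ ℚ` has good reduction at `p`** (the model is minimal at
`p` with unit discriminant; the tree's `hasGoodReductionAtPrime_shortWeierstrass_of_not_dvd_Δ` for arbitrary `M`).
[cite: SilvermanAEC2009, VII.1 Remark 1.1 and VII.5 Prop. 5.1(a)] -/
theorem hasGoodReductionAtPrime_baseChange_int_of_not_dvd_Δ (M : WeierstrassCurve ℤ) (p : ℕ) [hp : Fact p.Prime]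
    (hΔ : ¬ (p : ℤ) ∣ M.Δ) : (M.baseChange ℚ).HasGoodReductionAtPrime p := by
  obtain ⟨v, rfl⟩ : ∃ v : HeightOneSpectrum ℤ, (primesEquiv v : ℕ) = p :=
    ⟨primesEquiv.symm ⟨p, hp.out⟩, by rw [Equiv.apply_symm_apply]⟩
  rw [hasGoodReductionAtPrime_primesEquiv_iff_hasGoodReductionAt]
  have hmin : (M.baseChange ℚ).IsMinimalAt v :=
    isMinimalAt_baseChange_int_of_not_pow_dvd_Δ fun h ↦ hΔ ((dvd_pow_self _ (by norm_num)).trans h)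
  rw [hasGoodReductionAt_iff_of_isMinimalAt hmin, baseChange_int_Δ, Rat.valuation_intCast_eq_one_iff]
  exact hΔ

/-! ## §1 The member at `3`-adic distance `n′` from the centre: exact divisibilities -/

section Algebra

variable {R : Type*} [CommRing R] {c₄ c₆ t δ : R}

/-- `𝔠₄(−c₆ + tc₄, c₄) = t⁴·A` with `A = c₄⁵ − 13824c₄²c₆δ + 10368c₄³tδ − 8957952c₄t²δ²`, given `c₄³ − c₆² = 1728t³δ`
(Taylor expansion of Fisher's `𝔠₄` at `−c₆/c₄`: the cubic term vanishes). [cite: Fisher2012Hessian, §8 (𝔠₄ for n = 3)] -/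
theorem hesseC4_member_eq (hD : c₄ ^ 3 - c₆ ^ 2 = 1728 * t ^ 3 * δ) :
    c₄ * (-c₆ + t * c₄) ^ 4 + 4 * c₆ * (-c₆ + t * c₄) ^ 3 * c₄ + 6 * c₄ ^ 2 * (-c₆ + t * c₄) ^ 2 * c₄ ^ 2 +
        4 * c₄ * c₆ * (-c₆ + t * c₄) * c₄ ^ 3 + (4 * c₆ ^ 2 - 3 * c₄ ^ 3) * c₄ ^ 4 =
      t ^ 4 * (c₄ ^ 5 - 13824 * c₄ ^ 2 * c₆ * δ + 10368 * c₄ ^ 3 * t * δ - 8957952 * c₄ * t ^ 2 * δ ^ 2) := by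
  linear_combination (-5184 * c₄ * t ^ 3 * δ + 3 * c₄ * c₆ ^ 2 - 8 * c₄ ^ 2 * c₆ * t + 6 * c₄ ^ 3 * t ^ 2
    - 3 * c₄ ^ 4) * hD

/-- `𝔠₆(−c₆ + tc₄, c₄) = t⁶·B` with the integer polynomial `B ≡ c₄⁶c₆ (mod 3)` displayed, given `c₄³ − c₆² = 1728t³δ`.
[cite: Fisher2012Hessian, §8 (𝔠₆ for n = 3)] -/
theorem hesseC6_member_eq (hD : c₄ ^ 3 - c₆ ^ 2 = 1728 * t ^ 3 * δ) :
    c₆ * (-c₆ + t * c₄) ^ 6 + 6 * c₄ ^ 2 * (-c₆ + t * c₄) ^ 5 * c₄ +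
        15 * c₄ * c₆ * (-c₆ + t * c₄) ^ 4 * c₄ ^ 2 + 20 * c₆ ^ 2 * (-c₆ + t * c₄) ^ 3 * c₄ ^ 3 +
        15 * c₄ ^ 2 * c₆ * (-c₆ + t * c₄) ^ 2 * c₄ ^ 4 + (18 * c₄ ^ 4 - 12 * c₄ * c₆ ^ 2) * (-c₆ + t * c₄) * c₄ ^ 5 +
        (9 * c₄ ^ 3 * c₆ - 8 * c₆ ^ 3) * c₄ ^ 6 =
      t ^ 6 * (c₄ ^ 6 * c₆ + 34560 * c₄ ^ 6 * δ - 23887872 * c₄ ^ 3 * c₆ * δ ^ 2 +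
        35831808 * c₄ ^ 4 * t * δ ^ 2 - 25920 * c₄ ^ 4 * c₆ * t * δ + 10368 * c₄ ^ 5 * t ^ 2 * δ +
        44789760 * c₄ ^ 2 * c₆ * t ^ 2 * δ ^ 2 - 59719680 * c₄ ^ 3 * t ^ 3 * δ ^ 2 - 5159780352 * c₆ * t ^ 3 * δ ^ 3 +
        30958682112 * c₄ * t ^ 4 * δ ^ 3) := by
  linear_combination (-2985984 * c₆ * t ^ 6 * δ ^ 2 + 1728 * c₆ ^ 3 * t ^ 3 * δ - c₆ ^ 5 + 17915904 * c₄ * t ^ 7 * δ ^ 2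
    - 10368 * c₄ * c₆ ^ 2 * t ^ 4 * δ + 6 * c₄ * c₆ ^ 4 * t + 25920 * c₄ ^ 2 * c₆ * t ^ 5 * δ
    - 15 * c₄ ^ 2 * c₆ ^ 3 * t ^ 2 - 34560 * c₄ ^ 3 * t ^ 6 * δ - 15552 * c₄ ^ 3 * c₆ * t ^ 3 * δ
    + 20 * c₄ ^ 3 * c₆ ^ 2 * t ^ 3 + 10 * c₄ ^ 3 * c₆ ^ 3 + 31104 * c₄ ^ 4 * t ^ 4 * δ - 15 * c₄ ^ 4 * c₆ * t ^ 4
    - 24 * c₄ ^ 4 * c₆ ^ 2 * t + 6 * c₄ ^ 5 * t ^ 5 + 15 * c₄ ^ 5 * c₆ * t ^ 2 - 9 * c₄ ^ 6 * c₆ + 18 * c₄ ^ 7 * t) * hD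

/-- `𝔇(−c₆ + tc₄, c₄) = t³·G` with `G = −4c₄³c₆ − 6912c₄³δ + t(c₄⁴ + 6912c₄c₆δ) − 10368c₄²t²δ + 2985984t³δ²`, given
`c₄³ − c₆² = 1728t³δ`. [cite: Fisher2012Hessian, §8 (𝔇 for n = 3)] -/
theorem hesseD_member_eq (hD : c₄ ^ 3 - c₆ ^ 2 = 1728 * t ^ 3 * δ) :
    (-c₆ + t * c₄) ^ 4 - 6 * c₄ * (-c₆ + t * c₄) ^ 2 * c₄ ^ 2 - 8 * c₆ * (-c₆ + t * c₄) * c₄ ^ 3 - 3 * c₄ ^ 2 * c₄ ^ 4 =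
      t ^ 3 * (-4 * c₄ ^ 3 * c₆ - 6912 * c₄ ^ 3 * δ + t * (c₄ ^ 4 + 6912 * c₄ * c₆ * δ) - 10368 * c₄ ^ 2 * t ^ 2 * δ +
        2985984 * t ^ 3 * δ ^ 2) := by
  linear_combination (1728 * t ^ 3 * δ - c₆ ^ 2 + 4 * c₄ * c₆ * t - 6 * c₄ ^ 2 * t ^ 2 - 3 * c₄ ^ 3) * hD

end Algebra

/-! ## §2–§4 The good twin -/

/-- **A multiplicative-at-`3` curve with `3 ∣ v₃(Δ_min)` (peu ramifié) has a `3`-congruent twin with GOOD reduction at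
`3`** — a global minimal model of the Hesse-pencil member at `(−c₆ + 3^{v₃(Δ)/3}c₄ : c₄)` (module docstring).
[cite: Fisher2012Hessian, Thm. 13.2 (n = 3)] [cite: SilvermanAEC2009, VII.5 Prop. 5.1] -/
theorem exists_good_twin_of_mult_of_three_dvd_padicValInt (W' : WeierstrassCurve ℚ) [W'.IsElliptic]
    [W'.IsGloballyMinimal] (hm : Mult W' 3) (hdvd : 3 ∣ padicValInt 3 W'.minimalDiscriminantInt) :
    ∃ (W'' : WeierstrassCurve ℚ) (_ : W''.IsElliptic) (_ : W''.IsGloballyMinimal),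
      O6.ModPCongruent W'' W' 3 ∧ W''.HasGoodReductionAtPrime 3 := by
  -- ### the integral invariants of `W′`
  set c₄ : ℤ := (integralModelInt W').c₄ with hc₄def
  set c₆ : ℤ := (integralModelInt W').c₆ with hc₆def
  have hc4W : W'.c₄ = (c₄ : ℚ) := c₄_eq_intCast_c₄_integralModelInt W'
  have hc6W : W'.c₆ = (c₆ : ℚ) := c₆_eq_intCast_c₆_integralModelInt W'
  have hΔmin : W'.minimalDiscriminantInt = (integralModelInt W').Δ := rfl
  have hrel : c₄ ^ 3 - c₆ ^ 2 = 1728 * W'.minimalDiscriminantInt := by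
    rw [hΔmin, (integralModelInt W').c_relation]
  have hΔ0 : W'.minimalDiscriminantInt ≠ 0 := minimalDiscriminantInt_ne_zero W'
  have hc4u : ¬ (3 : ℤ) ∣ c₄ := by
    have h := not_dvd_c₄_of_hasMultiplicativeReductionAtPrime W' 3 hm
    exact_mod_cast h
  -- ### `n = 3n′`, `t = 3^{n′}`, `Δ_min = t³·δ` with `3 ∤ δ`
  obtain ⟨n', hn'⟩ := hdvd
  have h1 : 1 ≤ padicValInt 3 W'.minimalDiscriminantInt := one_le_padicValInt_minimalDiscriminantInt W' hm
  have hn'0 : n' ≠ 0 := by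
    rintro rfl
    rw [mul_zero] at hn'
    omega
  obtain ⟨δ, hδ⟩ : ((3 : ℕ) : ℤ) ^ (3 * n') ∣ W'.minimalDiscriminantInt := by
    rw [← hn']
    exact padicValInt_dvd _
  have hδ3 : ¬ (3 : ℤ) ∣ δ := by
    rintro ⟨δ', rfl⟩
    have h : ((3 : ℕ) : ℤ) ^ (3 * n' + 1) ∣ W'.minimalDiscriminantInt := ⟨δ', by rw [hδ]; push_cast; ring⟩
    have h' := ((padicValInt_dvd_iff (3 * n' + 1) W'.minimalDiscriminantInt).mp h).resolve_left hΔ0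
    omega
  set t : ℤ := 3 ^ n' with htdef
  have ht3 : (3 : ℤ) ∣ t := dvd_pow_self 3 hn'0
  have ht0 : t ≠ 0 := pow_ne_zero _ (by norm_num)
  have hD : c₄ ^ 3 - c₆ ^ 2 = 1728 * t ^ 3 * δ := by
    rw [hrel, hδ, htdef, ← pow_mul, mul_comm n' 3]
    push_cast
    ring
  have hc6u : ¬ (3 : ℤ) ∣ c₆ := by
    rintro ⟨x, hx⟩
    apply hc4u
    have h3 : (3 : ℤ) ∣ c₄ ^ 3 :=
      ⟨3 * x ^ 2 + 576 * t ^ 3 * δ, by linear_combination hD + (c₆ + 3 * x) * hx⟩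
    exact Int.prime_three.dvd_of_dvd_pow h3
  -- ### the integers `A`, `B`, `G`
  set A : ℤ := c₄ ^ 5 - 13824 * c₄ ^ 2 * c₆ * δ + 10368 * c₄ ^ 3 * t * δ - 8957952 * c₄ * t ^ 2 * δ ^ 2 with hAdef
  set B : ℤ := c₄ ^ 6 * c₆ + 34560 * c₄ ^ 6 * δ - 23887872 * c₄ ^ 3 * c₆ * δ ^ 2 +
        35831808 * c₄ ^ 4 * t * δ ^ 2 - 25920 * c₄ ^ 4 * c₆ * t * δ + 10368 * c₄ ^ 5 * t ^ 2 * δ +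
        44789760 * c₄ ^ 2 * c₆ * t ^ 2 * δ ^ 2 - 59719680 * c₄ ^ 3 * t ^ 3 * δ ^ 2 - 5159780352 * c₆ * t ^ 3 * δ ^ 3 +
        30958682112 * c₄ * t ^ 4 * δ ^ 3 with hBdef
  set G : ℤ := -4 * c₄ ^ 3 * c₆ - 6912 * c₄ ^ 3 * δ + t * (c₄ ^ 4 + 6912 * c₄ * c₆ * δ) - 10368 * c₄ ^ 2 * t ^ 2 * δ +
        2985984 * t ^ 3 * δ ^ 2 with hGdef
  have hA4 := hesseC4_member_eq hD
  have hB6 := hesseC6_member_eq hD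
  have hG3 := hesseD_member_eq hD
  -- the syzygy `𝔠₄³ − 𝔠₆² = (c₄³ − c₆²)𝔇³` at the member, divided by `t¹²`
  have hAB : A ^ 3 - B ^ 2 = 1728 * δ * G ^ 3 := by
    rw [hAdef, hBdef, hGdef]
    linear_combination (26623333280885243904 * t ^ 6 * δ ^ 6 + 277326388342554624 * c₄ ^ 2 * t ^ 5 * δ ^ 5
      + 246512345193381888 * c₄ ^ 3 * t ^ 3 * δ ^ 5 + 570630428688384 * c₄ ^ 3 * c₆ * t ^ 3 * δ ^ 4
      - 1150176957825024 * c₄ ^ 4 * t ^ 4 * δ ^ 4 + 1283918464548864 * c₄ ^ 5 * t ^ 2 * δ ^ 4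
      - 990677827584 * c₄ ^ 5 * c₆ * t ^ 2 * δ ^ 3 + 570630428688384 * c₄ ^ 6 * δ ^ 4
      + 1135151677440 * c₄ ^ 6 * t ^ 3 * δ ^ 3 + 2641807540224 * c₄ ^ 6 * c₆ * δ ^ 3
      - 2724364025856 * c₄ ^ 7 * t * δ ^ 3 + 573308928 * c₄ ^ 7 * c₆ * t * δ ^ 2 - 385191936 * c₄ ^ 8 * t ^ 2 * δ ^ 2
      - 1194393600 * c₄ ^ 9 * δ ^ 2 - 110592 * c₄ ^ 9 * c₆ * δ + 31104 * c₄ ^ 10 * t * δ + c₄ ^ 12) * hD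
  -- ### `A`, `G` are `3`-adic units
  have hA3 : ¬ (3 : ℤ) ∣ A := by
    intro hA
    apply hc4u
    have h5 : (3 : ℤ) ∣ c₄ ^ 5 := by
      have hx : c₄ ^ 5 = A + 3 * (4608 * c₄ ^ 2 * c₆ * δ - 3456 * c₄ ^ 3 * t * δ + 2985984 * c₄ * t ^ 2 * δ ^ 2) := by
        rw [hAdef]; ring
      rw [hx]
      exact dvd_add hA (dvd_mul_right 3 _)
    exact Int.prime_three.dvd_of_dvd_pow h5
  have hG3' : ¬ (3 : ℤ) ∣ G := by
    intro hG
    have hx : 4 * c₄ ^ 3 * c₆ = -G + t * (c₄ ^ 4 + 6912 * c₄ * c₆ * δ) +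
        3 * (-2304 * c₄ ^ 3 * δ - 3456 * c₄ ^ 2 * t ^ 2 * δ + 995328 * t ^ 3 * δ ^ 2) := by
      rw [hGdef]; ring
    have h4 : (3 : ℤ) ∣ 4 * c₄ ^ 3 * c₆ := by
      rw [hx]
      exact dvd_add (dvd_add (dvd_neg.mpr hG) (dvd_mul_of_dvd_left ht3 _)) (dvd_mul_right 3 _)
    rcases Int.prime_three.dvd_or_dvd h4 with h | h
    · rcases Int.prime_three.dvd_or_dvd h with h' | h'
      · norm_num at h'
      · exact hc4u (Int.prime_three.dvd_of_dvd_pow h')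
    · exact hc6u h
  have hG0 : G ≠ 0 := fun h ↦ hG3' (h ▸ dvd_zero 3)
  -- ### `ρ` with `27 ∣ Aρ + B`; then `3 ∣ ρ² − A`, `27 ∣ ρ³ − 3Aρ − 2B`
  obtain ⟨a, b, hab⟩ := Irreducible.coprime_pow_of_not_dvd 3 Int.prime_three.irreducible hA3
  set ρ : ℤ := -(a * B) with hρdef
  have hρ : A * ρ + B = 3 ^ 3 * (b * B) := by
    rw [hρdef]; linear_combination (-B) * hab
  have hk4' : (3 : ℤ) ^ 3 ∣ A ^ 2 * (ρ ^ 2 - A) := by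
    have hx : A ^ 2 * (ρ ^ 2 - A) = (A * ρ + B) * (A * ρ - B) - 1728 * δ * G ^ 3 := by
      linear_combination (-1 : ℤ) * hAB
    rw [hx, hρ]
    exact dvd_sub (dvd_mul_of_dvd_left (dvd_mul_right _ _) _) ⟨64 * δ * G ^ 3, by ring⟩
  have h3A : (3 : ℤ) ∣ ρ ^ 2 - A := by
    have h := (dvd_pow_self (3 : ℤ) (by norm_num : (3 : ℕ) ≠ 0)).trans hk4'
    rcases Int.prime_three.dvd_or_dvd h with h' | h'
    · exact absurd (Int.prime_three.dvd_of_dvd_pow h') hA3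
    · exact h'
  have h27 : (3 : ℤ) ^ 3 ∣ ρ ^ 3 - 3 * A * ρ - 2 * B := by
    have hcop3 : IsCoprime ((3 : ℤ) ^ 3) (A ^ 3) :=
      (Irreducible.coprime_pow_of_not_dvd 3 Int.prime_three.irreducible hA3).symm.pow_right
    refine hcop3.dvd_of_dvd_mul_left ?_
    have hid : A ^ 3 * (ρ ^ 3 - 3 * A * ρ - 2 * B) =
        (A * ρ + B) * ((A * ρ + B) ^ 2 - 3 * B * (A * ρ + B) + 3 * B ^ 2 - 3 * A ^ 3) + B * (A ^ 3 - B ^ 2) := by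
      ring
    rw [hid, hρ, hAB]
    exact dvd_add (dvd_mul_of_dvd_left (dvd_mul_right _ _) _) ⟨B * (64 * δ * G ^ 3), by ring⟩
  obtain ⟨k₄, hk₄⟩ := h3A
  obtain ⟨k₆, hk₆⟩ := h27
  -- ### the integer model `M = [0, ρ, 0, k₄, k₆]`: `c₄ = 16A`, `c₆ = 64B`, `Δ = 2¹²δG³`
  set M : WeierstrassCurve ℤ := ⟨0, ρ, 0, k₄, k₆⟩ with hMdef
  have hMc4 : M.c₄ = 16 * A := by
    simp only [hMdef, WeierstrassCurve.c₄, WeierstrassCurve.b₂, WeierstrassCurve.b₄]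
    linear_combination (16 : ℤ) * hk₄
  have hMc6 : M.c₆ = 64 * B := by
    simp only [hMdef, WeierstrassCurve.c₆, WeierstrassCurve.b₂, WeierstrassCurve.b₄, WeierstrassCurve.b₆]
    linear_combination (-96 * ρ) * hk₄ + 32 * hk₆
  have hMΔ : M.Δ = 2 ^ 12 * δ * G ^ 3 := by
    have h := M.c_relation
    rw [hMc4, hMc6] at h
    have h' : (1728 : ℤ) * M.Δ = 1728 * (2 ^ 12 * δ * G ^ 3) := by
      rw [h]; linear_combination (4096 : ℤ) * hAB
    exact mul_left_cancel₀ (by norm_num) h'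
  have hMΔ3 : ¬ (3 : ℤ) ∣ M.Δ := by
    rw [hMΔ]
    intro h
    rcases Int.prime_three.dvd_or_dvd h with h1 | h1
    · rcases Int.prime_three.dvd_or_dvd h1 with h2 | h2
      · have h3 := Int.prime_three.dvd_of_dvd_pow h2
        norm_num at h3
      · exact hδ3 h2
    · exact hG3' (Int.prime_three.dvd_of_dvd_pow h1)
  -- ### the member over `ℚ` and the change of variables `(u, r) = (3t, 3t²ρ)`
  have hDq : (c₄ : ℚ) ^ 3 - (c₆ : ℚ) ^ 2 = 1728 * (t : ℚ) ^ 3 * (δ : ℚ) := by exact_mod_cast hD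
  have htq : (t : ℚ) ≠ 0 := by exact_mod_cast ht0
  have h3tq : (3 : ℚ) * (t : ℚ) ≠ 0 := mul_ne_zero (by norm_num) htq
  have hAq : ((A : ℤ) : ℚ) = (c₄ : ℚ) ^ 5 - 13824 * (c₄ : ℚ) ^ 2 * c₆ * δ + 10368 * (c₄ : ℚ) ^ 3 * t * δ -
      8957952 * (c₄ : ℚ) * t ^ 2 * δ ^ 2 := by
    rw [hAdef]; push_cast; ring
  have hBq : ((B : ℤ) : ℚ) = (c₄ : ℚ) ^ 6 * c₆ + 34560 * (c₄ : ℚ) ^ 6 * δ - 23887872 * (c₄ : ℚ) ^ 3 * c₆ * δ ^ 2 +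
      35831808 * (c₄ : ℚ) ^ 4 * t * δ ^ 2 - 25920 * (c₄ : ℚ) ^ 4 * c₆ * t * δ + 10368 * (c₄ : ℚ) ^ 5 * t ^ 2 * δ +
      44789760 * (c₄ : ℚ) ^ 2 * c₆ * t ^ 2 * δ ^ 2 - 59719680 * (c₄ : ℚ) ^ 3 * t ^ 3 * δ ^ 2 -
      5159780352 * (c₆ : ℚ) * t ^ 3 * δ ^ 3 + 30958682112 * (c₄ : ℚ) * t ^ 4 * δ ^ 3 := by
    rw [hBdef]; push_cast; ring
  have hGq : ((G : ℤ) : ℚ) = -4 * (c₄ : ℚ) ^ 3 * c₆ - 6912 * (c₄ : ℚ) ^ 3 * δ + t * ((c₄ : ℚ) ^ 4 + 6912 * c₄ * c₆ * δ) -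
      10368 * (c₄ : ℚ) ^ 2 * t ^ 2 * δ + 2985984 * (t : ℚ) ^ 3 * δ ^ 2 := by
    rw [hGdef]; push_cast; ring
  have hmem : hessePencil3 W'.c₄ W'.c₆ (-(c₆ : ℚ) + t * c₄) (c₄ : ℚ) =
      ⟨0, 0, 0, -27 * ((t : ℚ) ^ 4 * (A : ℚ)), -54 * ((t : ℚ) ^ 6 * (B : ℚ))⟩ := by
    rw [hessePencil3_eq, hc4W, hc6W, hAq, hBq]
    simp only [WeierstrassCurve.mk.injEq, true_and]
    exact ⟨by linear_combination (-27 : ℚ) * hesseC4_member_eq hDq,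
      by linear_combination (-54 : ℚ) * hesseC6_member_eq hDq⟩
  -- the member is an elliptic curve: `𝔇 = t³G ≠ 0`
  haveI hell : (hessePencil3 W'.c₄ W'.c₆ (-(c₆ : ℚ) + t * c₄) (c₄ : ℚ)).IsElliptic :=
    isElliptic_hessePencil3_of_eval_hesseD3_ne_zero W'.c₄ W'.c₆ _ _ (by
      rw [eval_hesseD3, hc4W, hc6W]
      have h := hesseD_member_eq hDq
      have h' : (-(c₆ : ℚ) + ↑t * ↑c₄) ^ 4 - 6 * ↑c₄ * (-(c₆ : ℚ) + ↑t * ↑c₄) ^ 2 * (c₄ : ℚ) ^ 2 -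
          8 * ↑c₆ * (-(c₆ : ℚ) + ↑t * ↑c₄) * (c₄ : ℚ) ^ 3 - 3 * (c₄ : ℚ) ^ 2 * (c₄ : ℚ) ^ 4 =
          (t : ℚ) ^ 3 * (G : ℚ) := by rw [hGq]; linear_combination h
      rw [h']
      exact mul_ne_zero (pow_ne_zero 3 htq) (by exact_mod_cast hG0))
  set C₁ : VariableChange ℚ := ⟨Units.mk0 ((3 : ℚ) * t) h3tq, 3 * (t : ℚ) ^ 2 * ρ, 0, 0⟩ with hC₁
  have hk₄q : (ρ : ℚ) ^ 2 - A = 3 * k₄ := by exact_mod_cast hk₄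
  have hk₆q : (ρ : ℚ) ^ 3 - 3 * A * ρ - 2 * B = 3 ^ 3 * k₆ := by exact_mod_cast hk₆
  have hkey : C₁ • hessePencil3 W'.c₄ W'.c₆ (-(c₆ : ℚ) + t * c₄) (c₄ : ℚ) = M.baseChange ℚ := by
    rw [hmem, variableChange_def, hMdef, hC₁]
    simp only [WeierstrassCurve.baseChange, WeierstrassCurve.map, Units.val_inv_eq_inv_val, Units.val_mk0,
      WeierstrassCurve.mk.injEq, algebraMap_int_eq, eq_intCast, Int.cast_zero]
    refine ⟨by ring, ?_, by ring, ?_, ?_⟩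
    · rw [inv_pow, inv_mul_eq_iff_eq_mul₀ (pow_ne_zero 2 h3tq)]
      ring
    · rw [inv_pow, inv_mul_eq_iff_eq_mul₀ (pow_ne_zero 4 h3tq)]
      linear_combination (27 * (t : ℚ) ^ 4) * hk₄q
    · rw [inv_pow, inv_mul_eq_iff_eq_mul₀ (pow_ne_zero 6 h3tq)]
      linear_combination (27 * (t : ℚ) ^ 6) * hk₆q
  -- ### a global minimal model of the member is the twin
  obtain ⟨C, hC⟩ :=
    WeierstrassCurve.hasGlobalMinimalModel_rat_holds (hessePencil3 W'.c₄ W'.c₆ (-(c₆ : ℚ) + t * c₄) (c₄ : ℚ))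
  refine ⟨C • hessePencil3 W'.c₄ W'.c₆ (-(c₆ : ℚ) + t * c₄) (c₄ : ℚ), inferInstance, hC, ?_, ?_⟩
  · -- `3`-congruence: Fisher Thm. 13.2 transported along `C`
    obtain ⟨e₁, he₁⟩ := threeCongruent_hessePencil3_unconditional W' (-(c₆ : ℚ) + t * c₄) (c₄ : ℚ)
    obtain ⟨e₂, he₂⟩ :=
      (hessePencil3 W'.c₄ W'.c₆ (-(c₆ : ℚ) + t * c₄) (c₄ : ℚ)).exists_geomTorsion_addEquiv_smul C 3
    refine ⟨e₂.symm.trans e₁, fun σ P ↦ ?_⟩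
    simp only [AddEquiv.trans_apply]
    rw [← he₁]
    congr 1
    apply e₂.injective
    rw [AddEquiv.apply_symm_apply, he₂, AddEquiv.apply_symm_apply]
  · -- good reduction at `3`: rescale to the integer model `M`, `3 ∤ Δ(M)`
    haveI := hC
    rw [← hasGoodReductionAtPrime_smul_iff _ (C₁ * C⁻¹) 3, mul_smul, inv_smul_smul, hkey]
    exact hasGoodReductionAtPrime_baseChange_int_of_not_dvd_Δ M 3 hMΔ3

/-! ## §5 The route's support item `S_A` -/

/-- **`PeuRamifieMultTwinResupplyAtThree` (item stmt-BirchSwinnertonDyer-27387) HOLDS**: a wild curve handed a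
multiplicative `3`-congruent twin `W′` with `3 ∣ v₃(Δ_min W′)` has a `3`-congruent twin `W″` off the peu-ramifié
multiplicative locus — indeed one with GOOD reduction at `3` (`exists_good_twin_of_mult_of_three_dvd_padicValInt`,
composed with the handed congruence). The hypotheses `ClassO6`, `r_an = 1`, `ρ̄₃` onto are not used. Unconditional.
[cite: Fisher2012Hessian, Thm. 13.2 (n = 3)] [cite: SilvermanAEC2009, VII.5 Prop. 5.1] -/
theorem peuRamifieMultTwinResupplyAtThree_proof :
    Summit.BirchSwinnertonDyer.BirchSwinnertonDyer.Theses.UniversalToricDescent.PeuRamifieMultTwinResupplyAtThree :=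
  UniversalToricDescentKernelDefectPTTROfPrint.peuRamifieMultTwinResupplyAtThree_of_goodOrd
    fun W _ _ _ _ _ hpeu ↦ by
      obtain ⟨W', hE', hM', hcong, hmult, hdvd⟩ := hpeu
      haveI := hE'
      haveI := hM'
      obtain ⟨W'', e, m, hc, hg⟩ := exists_good_twin_of_mult_of_three_dvd_padicValInt W' hmult hdvd
      exact ⟨W'', e, m, modPCongruent_trans hc hcong, hg⟩

end Summit.BirchSwinnertonDyer.BirchSwinnertonDyer.Theorems.UniversalToricDescentPeuRamifieResupply

end
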